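import Summits.HodgeConjecture.HodgeConjecture.Theorems.Ring2HypothesesDescentAbsoluteExteriorStabilizerPowersTower
import HarnessLib

/-!
# Ring 2 — hypotheses layer, descent axis: `G(A^{r+1}) = G(A)` ACTING DIAGONALLY, part 3 of 3 — POWER-INVARIANCE OF THE PRICES OF
# THE TANNAKA-FREE DICTIONARY (`Hg = S`, `G¹_alg = Hg`, `G¹_mot = Hg`, `G¹_alg = G¹_mot`, `G¹_alg = S`, `G¹_alg ≤ G¹_AH`, `G¹_AH = Hg`)

HONEST FRAMING (page 1, verbatim the cell's standing line): **research route conditional on HC_CM; not a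
corollary; Q11.4-sentence-2 already refuted in dim ≥ 3.** Nothing in this file proves a case of the Hodge conjecture;
nothing discharges the binder of record b06 `Ring2.Hypotheses.AbsoluteHodgeImpliesAlgebraicAV` («absolute Hodge classes
on complex abelian varieties are algebraic», `Ring2HypothesesDescent.lean` :73; OPEN); the binder table's numbers do not
move. `HC_CM` (`Theses.RankFourFaces.CMAbelianHodge`), `HC_AV` and row b06 are ABSENT from this file. Hodge ladder STAGE 3,
`BINDER-OWNERS.md` row **b06**, seat `ring2-b06` (gen 86). Companion of `…ExteriorStabilizerPowers` (transfer
`StabilizerPowers.le_powSucc_iff` / `eq_powSucc_iff`) and `…ExteriorStabilizerPowersTower` (admissibility of the five systems).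

* `Hg(A^{r+1}) = S(A^{r+1}) ⟺ Hg(A) = S(A)` (Milne's (c) of Prop. 4.8; fact-free — through (a) «no exotic Hodge classes on any power»
  a tautology, here group-theoretically); `G¹_alg(A^{r+1}) = Hg(A^{r+1}) ⟺ G¹_alg(A) = Hg(A)` (typer 2's price of HC on the powers;
  fact-free); `G¹_mot = Hg` likewise (the Literature's price of «Hodge ⟹ motivated»; fact-free); `G¹_alg = G¹_mot` likewise (row
  b05's group price; fact-free); `G¹_alg = S` likewise (fact-free); THE ROW'S PRICE **`G¹_alg(A^{r+1}) ≤ G¹_AH(A^{r+1}) ⟺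
  G¹_alg(A) ≤ G¹_AH(A)`** (mod c23 + c35 + (E)) — granted (P2), gen 81's «ROW ⟺ ∀ A, G¹_alg(A) ≤ G¹_AH(A)» may be tested on ONE
  member of each class `{A^{r+1} : r ≥ 0}`; and Deligne's Tannakian face `G¹_AH(A^{r+1}) = Hg(A^{r+1}) ⟺ G¹_AH(A) = Hg(A)`
  (mod c23 + c35 + (E); both sides hold mod c1).

HONEST COLUMN. No definition, no new named fact, no sorry; displayed facts of record c23, c35 and (E) as `hex` in the two absolute Hodge
statements only; everything else FACT-FREE; row b06 / `HC_AV` / `HC_CM` absent; nothing deciding the row. PRESEARCH: see part 1.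
References (bib keys): Milne1999LefschetzClasses (Prop. 4.8, Cor. 4.7), Andre1996Motifs (§6.2–6.3), MoonenZarhin1999LowDim (§1),
Deligne1982HodgeCycles (I §3 Thm. 3.8, I §5).
-/

noncomputable section

-- every declaration of this problem lives in `Summit.HodgeConjecture.HodgeConjecture.…` (summit = sub-problem)
set_option linter.dupNamespace false

namespace Summit.HodgeConjecture.HodgeConjecture.Ring2.Hypotheses

open CategoryTheory AlgebraicGeometry MonoidalCategory CartesianMonoidalCategory
open Literature.AlgebraicGeometry Literature.AlgebraicGeometry.Motives
open Literature.AlgebraicGeometry.HodgeTheory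
open Literature.AlgebraicTopology.SingularHomology
open Literature.Barriers.HodgeConjecture (divisorClassesSpan)
open Literature.AlgebraicGeometry.Milne1999 (specialLefschetzGroup lefschetzPowClasses centralizerGroup diagPow diagPowExterior
  exteriorKunnethFamily exteriorPullbackEquiv castAut)

/-! ## §3 Power-invariance of the prices of the dictionary -/

section Prices

variable (A : AbelianVariety ℂ) (r : ℕ)

/-- **Milne's (c) of Prop. 4.8 is power-invariant — `Hg(A^{r+1}) = S(A^{r+1}) ⟺ Hg(A) = S(A)`** — FACT-FREE (group-theoretically;
through (a) «no exotic Hodge classes on any power» it is a tautology). [cite: Milne1999LefschetzClasses, Prop. 4.8 and Cor. 4.7]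
[cite: MoonenZarhin1999LowDim, §1] -/
theorem hodgeGroup_eq_specialLefschetzGroup_powSucc_iff :
    hodgeGroup (A.powSucc r).dim (A.powSucc r).X = specialLefschetzGroup (A.powSucc r).dim (A.powSucc r).X ↔
      hodgeGroup A.dim A.X = specialLefschetzGroup A.dim A.X := by
  have h := @StabilizerPowers.eq_powSucc_iff
    (fun N Y p ↦ {c : complexBetti Y (2 * p) | IsRationalClass c ∧ IsOfHodgeType N Y (2 * p) p p c})
    (fun N Y p ↦ (divisorClassesSpan Y N p : Set _)) hodgeGroup_admissibleS hodgeClasses_admissibleP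
    specialLefschetzGroup_admissibleS divisorClassesSpan_admissibleP A r
  exact h

/-- **Typer 2's price of the Hodge conjecture on the powers is power-invariant — `G¹_alg(A^{r+1}) = Hg(A^{r+1}) ⟺ G¹_alg(A) = Hg(A)`**
— FACT-FREE. [cite: Andre1996Motifs, §6.2–6.3 (p. 31)] [cite: MoonenZarhin1999LowDim, §1] -/
theorem algebraicStabilizer_eq_hodgeGroup_powSucc_iff :
    algebraicStabilizer (A.powSucc r).X = hodgeGroup (A.powSucc r).dim (A.powSucc r).X ↔
      algebraicStabilizer A.X = hodgeGroup A.dim A.X := by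
  have h := @StabilizerPowers.eq_powSucc_iff (fun _ Y p ↦ (algebraicClasses Y p : Set _))
    (fun N Y p ↦ {c : complexBetti Y (2 * p) | IsRationalClass c ∧ IsOfHodgeType N Y (2 * p) p p c})
    algebraicStabilizer_admissibleS algebraicClasses_admissibleP hodgeGroup_admissibleS hodgeClasses_admissibleP A r
  exact h

/-- **Typer 2's price of `HC_AV` is power-invariant — `G¹_alg(A^{r+1}) ≤ Hg(A^{r+1}) ⟺ G¹_alg(A) ≤ Hg(A)`** (part XXXVI-B:
`HC_AV ⟺ (P2) ∧ [∀ A, G¹_alg(A) ≤ Hg(A)]`; granted (P2) the bracket may be tested on one member of each class `{A^{r+1} : r ≥ 0}`) —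
FACT-FREE. [cite: Andre1996Motifs, §6.2–6.3 (p. 31)] [cite: MoonenZarhin1999LowDim, §1] -/
theorem algebraicStabilizer_le_hodgeGroup_powSucc_iff :
    algebraicStabilizer (A.powSucc r).X ≤ hodgeGroup (A.powSucc r).dim (A.powSucc r).X ↔
      algebraicStabilizer A.X ≤ hodgeGroup A.dim A.X := by
  have h := @StabilizerPowers.le_powSucc_iff (fun _ Y p ↦ (algebraicClasses Y p : Set _))
    (fun N Y p ↦ {c : complexBetti Y (2 * p) | IsRationalClass c ∧ IsOfHodgeType N Y (2 * p) p p c})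
    algebraicStabilizer_admissibleS algebraicClasses_admissibleP hodgeGroup_admissibleS hodgeClasses_admissibleP A r
  exact h

/-- **The Literature's price of «Hodge ⟹ motivated» is power-invariant — `G¹_mot(A^{r+1}) = Hg(A^{r+1}) ⟺ G¹_mot(A) = Hg(A)`** —
FACT-FREE. [cite: Andre1996Motifs, §6.2–6.3 (p. 31)] [cite: MoonenZarhin1999LowDim, §1] -/
theorem specialMotivatedGaloisGroup_eq_hodgeGroup_powSucc_iff :
    specialMotivatedGaloisGroup (A.powSucc r).dim (A.powSucc r).X = hodgeGroup (A.powSucc r).dim (A.powSucc r).X ↔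
      specialMotivatedGaloisGroup A.dim A.X = hodgeGroup A.dim A.X := by
  have h := @StabilizerPowers.eq_powSucc_iff (fun N Y p ↦ (motivatedClasses N Y p : Set _))
    (fun N Y p ↦ {c : complexBetti Y (2 * p) | IsRationalClass c ∧ IsOfHodgeType N Y (2 * p) p p c})
    specialMotivatedGaloisGroup_admissibleS motivatedClasses_admissibleP hodgeGroup_admissibleS
    hodgeClasses_admissibleP A r
  exact h

/-- **Row b05's group price is power-invariant — `G¹_alg(A^{r+1}) = G¹_mot(A^{r+1}) ⟺ G¹_alg(A) = G¹_mot(A)`** — FACT-FREE.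
[cite: Andre1996Motifs, §6.2–6.3 (p. 31) and §4.6 (ii) (p. 24)] -/
theorem algebraicStabilizer_eq_specialMotivatedGaloisGroup_powSucc_iff :
    algebraicStabilizer (A.powSucc r).X = specialMotivatedGaloisGroup (A.powSucc r).dim (A.powSucc r).X ↔
      algebraicStabilizer A.X = specialMotivatedGaloisGroup A.dim A.X := by
  have h := @StabilizerPowers.eq_powSucc_iff (fun _ Y p ↦ (algebraicClasses Y p : Set _))
    (fun N Y p ↦ (motivatedClasses N Y p : Set _) ) algebraicStabilizer_admissibleS algebraicClasses_admissibleP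
    specialMotivatedGaloisGroup_admissibleS motivatedClasses_admissibleP A r
  exact h

/-- **Milne's (c) for `G¹_alg` is power-invariant — `G¹_alg(A^{r+1}) = S(A^{r+1}) ⟺ G¹_alg(A) = S(A)`** (⟺ algebraic classes on every
power are Lefschetz, gen 85's `algebraicStabilizer_eq_specialLefschetzGroup_iff`) — FACT-FREE. [cite: Milne1999LefschetzClasses, Prop. 4.8 and Cor. 4.7] -/
theorem algebraicStabilizer_eq_specialLefschetzGroup_powSucc_iff :
    algebraicStabilizer (A.powSucc r).X = specialLefschetzGroup (A.powSucc r).dim (A.powSucc r).X ↔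
      algebraicStabilizer A.X = specialLefschetzGroup A.dim A.X := by
  have h := @StabilizerPowers.eq_powSucc_iff (fun _ Y p ↦ (algebraicClasses Y p : Set _))
    (fun N Y p ↦ (divisorClassesSpan Y N p : Set _) ) algebraicStabilizer_admissibleS algebraicClasses_admissibleP
    specialLefschetzGroup_admissibleS divisorClassesSpan_admissibleP A r
  exact h

/-- **THE ROW'S PRICE IS POWER-INVARIANT — `G¹_alg(A^{r+1}) ≤ G¹_AH(A^{r+1}) ⟺ G¹_alg(A) ≤ G¹_AH(A)`** (mod c23 + c35 + (E)): granted
typer 2's (P2), gen 81's «`AbsoluteHodgeImpliesAlgebraicAV ⟺ ∀ A, G¹_alg(A) ≤ G¹_AH(A)`» may be tested on one member of each class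
`{A^{r+1} : r ≥ 0}`. [cite: Deligne1982HodgeCycles, I §3 Thm. 3.8 and §2 Example 2.1 (a)] [cite: Andre1996Motifs, §6.2 (p. 31)] -/
theorem algebraicStabilizer_le_absoluteHodgeStabilizer_powSucc_iff (hZ : deligne1982_cycleClass_absoluteHodge)
    (hN : chartConjugation_canonical)
    (hex : ∀ ⦃n : ℕ⦄ ⦃X : SchemeOver ℂ⦄, IsSmoothProjective n X →
      ∀ (σ : ℂ ≃+* ℂ) (p : ℕ) (c : complexBetti X (2 * p)), ∃ s, IsConjugateClass σ X (2 * p) c s) :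
    algebraicStabilizer (A.powSucc r).X ≤ powClassStabilizer (A.powSucc r).X
        (fun a p ↦ {c : complexBetti (cartesianPow (A.powSucc r).X (a + 1)) (2 * p) |
          IsAbsoluteHodgeClass (cartesianPowDim (A.powSucc r).dim a) (cartesianPow (A.powSucc r).X (a + 1)) p c}) ↔
      algebraicStabilizer A.X ≤ powClassStabilizer A.X (fun a p ↦ {c : complexBetti (cartesianPow A.X (a + 1)) (2 * p) |
        IsAbsoluteHodgeClass (cartesianPowDim A.dim a) (cartesianPow A.X (a + 1)) p c}) := by
  have h := @StabilizerPowers.le_powSucc_iff (fun _ Y p ↦ (algebraicClasses Y p : Set _))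
    (fun N Y p ↦ {c : complexBetti Y (2 * p) | IsAbsoluteHodgeClass N Y p c}) algebraicStabilizer_admissibleS
    algebraicClasses_admissibleP (absoluteHodgeStabilizer_admissibleS hZ) (absoluteHodgeClasses_admissibleP hN hex) A
    r
  exact h

/-- **Deligne's Tannakian face is power-invariant — `G¹_AH(A^{r+1}) = Hg(A^{r+1}) ⟺ G¹_AH(A) = Hg(A)`** (mod c23 + c35 + (E); both
sides hold mod c1, gen 81's `absoluteHodgeStabilizer_eq_hodgeGroup_abelianVariety_of_deligne`).
[cite: Deligne1982HodgeCycles, I §3 Thm. 3.8 and I §5 (closing lines)] [cite: MoonenZarhin1999LowDim, §1] -/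
theorem absoluteHodgeStabilizer_eq_hodgeGroup_powSucc_iff (hZ : deligne1982_cycleClass_absoluteHodge)
    (hN : chartConjugation_canonical)
    (hex : ∀ ⦃n : ℕ⦄ ⦃X : SchemeOver ℂ⦄, IsSmoothProjective n X →
      ∀ (σ : ℂ ≃+* ℂ) (p : ℕ) (c : complexBetti X (2 * p)), ∃ s, IsConjugateClass σ X (2 * p) c s) :
    powClassStabilizer (A.powSucc r).X
        (fun a p ↦ {c : complexBetti (cartesianPow (A.powSucc r).X (a + 1)) (2 * p) |
          IsAbsoluteHodgeClass (cartesianPowDim (A.powSucc r).dim a) (cartesianPow (A.powSucc r).X (a + 1)) p c}) =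
        hodgeGroup (A.powSucc r).dim (A.powSucc r).X ↔
      powClassStabilizer A.X (fun a p ↦ {c : complexBetti (cartesianPow A.X (a + 1)) (2 * p) |
        IsAbsoluteHodgeClass (cartesianPowDim A.dim a) (cartesianPow A.X (a + 1)) p c}) = hodgeGroup A.dim A.X := by
  have h := @StabilizerPowers.eq_powSucc_iff (fun N Y p ↦ {c : complexBetti Y (2 * p) | IsAbsoluteHodgeClass N Y p c})
    (fun N Y p ↦ {c : complexBetti Y (2 * p) | IsRationalClass c ∧ IsOfHodgeType N Y (2 * p) p p c})
    (absoluteHodgeStabilizer_admissibleS hZ) (absoluteHodgeClasses_admissibleP hN hex) hodgeGroup_admissibleS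
    hodgeClasses_admissibleP A r
  exact h

end Prices

end Summit.HodgeConjecture.HodgeConjecture.Ring2.Hypotheses

end
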